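import Summits.BirchSwinnertonDyer.BirchSwinnertonDyer.Theorems.KatoDescentPotSupersingularKummerLevelTransport
import Summits.BirchSwinnertonDyer.BirchSwinnertonDyer.Theorems.KatoDescentPotSupersingularKatoSelmerFinite
import Summits.BirchSwinnertonDyer.Rank1Residual.X11b.KummerRelaxedStructures
import HarnessLib

/-!
# Local and global inputs of the Poitou–Tate cokernel bound for Kato's `S(E[p^∞])`:
# (i) every class of `H¹_ur(K_v, E[p^∞])` killed by `p^K` comes from the propagated condition `ι_K⁻¹ H¹_ur` at level `p^K`;
# (ii) `Sel_{p^∞}(E/ℚ) ≤ S` and its classes VANISH at every `ℓ ≠ p`; (iii) the Kummer structure of level `p^s·p^K` is unramified at good `ℓ ∤ p`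
# (route `KatoDescentPotSupersingular` / `…Tame…`, crux M = stmt-BirchSwinnertonDyer-19196; route-free helper)

Seat `bsd-potss-rkm` g19 (prover; cell `bsd-potss`), item stmt-BirchSwinnertonDyer-19196 (`--supports … --as helper`; closes
nothing).  HONEST FRAMING: BSD is not proved by any of this; nothing is booked; theorems only (no definition, no named fact).

## Why (companion (ii) of brick (a) — memo `HOME/rkm/FINDING-19196-rkm-g19.md` §"What remains", steps P1 and F0)

* `exists_mem_comap_map_primaryInclusion_eq` — at a finite place `v`, every `u ∈ H¹_ur(K_v, E[p^∞])` with `p^K · u = 0` is `ι_K z` for some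
  `z ∈ (H¹_ur)⁻¹ := comap ι_K H¹_ur ≤ H¹(K_v, E[p^K])` (X11b `mem_range_map_primaryInclusion_restrictField_iff`): the local quotient
  `𝓖_{K,v}/𝓕_{K,v}` of the propagated pair IS `H¹_ur(K_v, E[p^∞])` for `K ≫ 0` — the surjectivity half of step P1.
* `localization_eq_zero_of_mem_selmerLocalKerPrimary` — over `ℚ`, a class of `H¹(ℚ, E[p^∞])` satisfying the `p^∞` Kummer condition at a
  finite `v ≠ v_p` is locally ZERO there ("`E(ℚ_ℓ) ⊗ ℚ_p/ℤ_p = 0`": through a finite level, the Kummer condition at `ℓ ∤ p` is `ker ι_k`, X11b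
  torsion saturation); hence **`selmerGroupPInfty_le_kato`: `Sel_{p^∞}(E/ℚ) ≤ S = H¹_{𝓤∞} ⊓ selmerLocalKerPrimary W ℚ_p p`** and
  `localization_eq_zero_of_mem_selmerGroupPInfty` — so `Sel_{p^∞}` is the KERNEL side of `S → ⊕_{ℓ≠p} H¹_ur` (with part 38's converse).
* `kummerSelmerStructure_inr_eq_unramifiedSubgroup_pow_mul_pow` — the level-`((p^s*p^K:ℕ):ℤ)` Kummer structure IS the unramified condition at
  a good `v ∤ p` (X11b, level `p^{s+K}`, transported along `pow_add`): `IsUnramifiedOutside` for the Poitou–Tate step.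

References: K. Kato, Astérisque 295 (2004) §14.8 [Kato2004Asterisque]; R. Greenberg, LNM 1716 §2, §5 [GreenbergLNM1716]; J. S. Milne, *ADT* I
Lemma 3.3, Prop. 3.8 [MilneADT2006]; J. H. Silverman, *AEC* VII.6.3, X.4.4 [SilvermanAEC2009].
-/

-- the summit and its single problem are both named `BirchSwinnertonDyer` (registry layout D-0017)
set_option linter.dupNamespace false
set_option autoImplicit false

noncomputable section

open scoped Classical ContRepresentation NumberField
open CategoryTheory Function Field NumberField IsDedekindDomain WeierstrassCurve
open Literature.NumberTheory.EllipticCurves Literature.NumberTheory.GaloisRepresentations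
  Literature.NumberTheory.GaloisRepresentations.DiscreteGaloisModule Literature.NumberTheory.GaloisCohomology
open Literature.NumberTheory.EllipticCurves.Kato2004
open Summit.BirchSwinnertonDyer.Rank1Residual.X11b.Levels Summit.BirchSwinnertonDyer.Rank1Residual.X11b.LocBridge
  Summit.BirchSwinnertonDyer.Rank1Residual.X11b.LevelKummer
open Summit.BirchSwinnertonDyer.Rank1Residual.GaloisImage

universe u

namespace Summit.BirchSwinnertonDyer.BirchSwinnertonDyer.Theorems.KatoFiniteLevelCount

/-! ## §1 The propagated unramified condition at level `p^K` surjects onto `H¹_ur(K_v, E[p^∞])[p^K]` -/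

section Local

variable {K : Type u} [Field K] [NumberField K] (W : WeierstrassCurve K) [W.IsElliptic] (p K₀ : ℕ) [Fact p.Prime]
  (v : HeightOneSpectrum (𝓞 K))

/-- **Every `u ∈ H¹_ur(K_v, E[p^∞])` with `p^{K₀} · u = 0` is `ι_{K₀} z` with `z ∈ ι_{K₀}⁻¹ H¹_ur(K_v, E[p^∞])`** (X11b's range criterion
`mem_range_map_primaryInclusion_restrictField_iff` — `E(K̄)` is divisible): for `p^{K₀} ≥ exp H¹_ur(K_v,E[p^∞])` the image of the propagated
condition `ι_{K₀}⁻¹ H¹_ur` under `ι_{K₀}` is ALL of `H¹_ur(K_v, E[p^∞])`. [cite: GreenbergLNM1716, §5 proof of Prop. 5.8] -/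
theorem exists_mem_comap_map_primaryInclusion_eq
    {u : galoisCohomology (GaloisRep.restrictField (v.adicCompletion K) (primaryGaloisModule W p)) 1}
    (hu : u ∈ unramifiedSubgroup (GaloisRep.toLocal v (primaryGaloisModule W p)) 1) (hK : p ^ K₀ • u = 0) :
    ∃ z ∈ (unramifiedSubgroup (GaloisRep.toLocal v (primaryGaloisModule W p)) 1).comap
        (galoisCohomology.map ((primaryInclusion W p K₀).restrictField (v.adicCompletion K)) 1),
      galoisCohomology.map ((primaryInclusion W p K₀).restrictField (v.adicCompletion K)) 1 z = u := by
  obtain ⟨z, hz⟩ := (mem_range_map_primaryInclusion_restrictField_iff W p K₀ (v.adicCompletion K)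
    W.zsmul_geomPoints_surjective_holds u).2 hK
  exact ⟨z, by rw [AddSubgroup.mem_comap, hz]; exact hu, hz⟩

/-- **Subgroup form**: `H¹_ur(K_v, E[p^∞]) ≤ ι_{K₀}(ι_{K₀}⁻¹ H¹_ur)` as soon as `p^{K₀}` kills `H¹_ur(K_v, E[p^∞])` (hence EQUALITY, the other
inclusion being tautological). [cite: GreenbergLNM1716, §5 proof of Prop. 5.8] -/
theorem unramifiedSubgroup_le_map_comap_primaryInclusion
    (hK : ∀ u ∈ unramifiedSubgroup (GaloisRep.toLocal v (primaryGaloisModule W p)) 1, p ^ K₀ • u = 0) :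
    unramifiedSubgroup (GaloisRep.toLocal v (primaryGaloisModule W p)) 1 ≤
      ((unramifiedSubgroup (GaloisRep.toLocal v (primaryGaloisModule W p)) 1).comap
        (galoisCohomology.map ((primaryInclusion W p K₀).restrictField (v.adicCompletion K)) 1)).map
        (galoisCohomology.map ((primaryInclusion W p K₀).restrictField (v.adicCompletion K)) 1) := by
  intro u hu
  obtain ⟨z, hz, hzu⟩ := exists_mem_comap_map_primaryInclusion_eq W p K₀ v hu (hK u hu)
  exact ⟨z, hz, hzu⟩

end Local

/-! ## §2 Over `ℚ`: `Sel_{p^∞}(E/ℚ) ≤ S`, and its classes vanish at every `ℓ ≠ p` -/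

section Rat

variable (W : WeierstrassCurve ℚ) [W.IsElliptic] (p : ℕ) [Fact p.Prime]

/-- **A class of `H¹(ℚ, E[p^∞])` which is Kummer (`selmerLocalKerPrimary`) at a finite `v ≠ v_p` is locally ZERO at `v`** ("`E(ℚ_v) ⊗ ℚ_p/ℤ_p = 0`
for `v ∤ p`"): write `c = ι_k c_k` (every class is `p^k`-torsion for some `k`, `E(ℚ̄)` divisible); `c_k` is Kummer at `v` (part 36
`mem_selmerLocalKer_iff_map_primaryInclusion_mem`), and at `v ∤ p` the level-`p^k` Kummer condition is `ker ι_k` (X11b torsion saturation).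
[cite: JetchevSkinnerWan2017, §2.2.3 (arXiv:1512.06894 p. 7)] [cite: SilvermanAEC2009, Prop. VII.6.3] -/
theorem localization_eq_zero_of_mem_selmerLocalKerPrimary {v : HeightOneSpectrum (𝓞 ℚ)} (hv : v ≠ primePlace p)
    {c : galoisCohomology (primaryGaloisModule W p) 1} (hc : c ∈ selmerLocalKerPrimary W (v.adicCompletion ℚ) p) :
    galoisCohomology.localization (primaryGaloisModule W p) (Sum.inr v) 1 c = 0 := by
  have hp : p.Prime := Fact.out
  -- `c` is `p^k`-torsion, hence `c = ι_k c_k`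
  have hB : ∀ Q : W.geomPrimaryTorsion p, ∃ k : ℕ, p ^ k • Q = 0 := fun Q =>
    (AddCommGroup.mem_primaryComponent.mp Q.2).imp fun k hk =>
      Subtype.ext (by rw [AddSubmonoidClass.coe_nsmul, hk, ZeroMemClass.coe_zero])
  obtain ⟨k, hk⟩ := exists_pow_nsmul_eq_zero_of_primary (primaryGaloisModule W p) hB c
  obtain ⟨ck, rfl⟩ := (mem_range_map_primaryInclusion_iff W p k W.zsmul_geomPoints_surjective_holds c).2 hk
  -- `c_k` is Kummer at `v`, i.e. `loc_v c_k ∈ 𝓚_k = ker ι_k`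
  have hck : galoisCohomology.localization (W.torsionGaloisModule ((p ^ k : ℕ) : ℤ)) (Sum.inr v) 1 ck ∈
      W.kummerSelmerStructure ((p ^ k : ℕ) : ℤ) (Sum.inr v) :=
    (localization_mem_kummerSelmerStructure_iff_map_primaryInclusion_mem W p k (Sum.inr v) ck).2 hc
  have hn : ((p ^ k : ℕ) : ℤ) ≠ 0 := Int.natCast_ne_zero.mpr (pow_ne_zero k hp.ne_zero)
  rw [WeierstrassCurve.kummerSelmerStructure_apply] at hck
  change _ ∈ W.kummerLocalConditionAt ((p ^ k : ℕ) : ℤ) (v.adicCompletion ℚ) at hck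
  rw [kummerLocalConditionAt_eq_ker_map_primaryInclusion W p k v (natCast_not_mem_of_ne_primePlace p hv) hn,
    AddMonoidHom.mem_ker] at hck
  rw [localization_map_one']
  exact hck

/-- **`Sel_{p^∞}(E/ℚ)`-classes vanish at every finite `v ≠ v_p`.** [cite: JetchevSkinnerWan2017, §2.2.3 (arXiv:1512.06894 p. 7)] -/
theorem localization_eq_zero_of_mem_selmerGroupPInfty {v : HeightOneSpectrum (𝓞 ℚ)} (hv : v ≠ primePlace p)
    {c : galoisCohomology (primaryGaloisModule W p) 1} (hc : c ∈ W.selmerGroupPInfty p) :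
    galoisCohomology.localization (primaryGaloisModule W p) (Sum.inr v) 1 c = 0 :=
  localization_eq_zero_of_mem_selmerLocalKerPrimary W p hv ((AddSubgroup.mem_iInf.1 (AddSubgroup.mem_inf.1 hc).1) v)

/-- **`Sel_{p^∞}(E/ℚ) ≤ S`** for Kato's `S = H¹_{𝓤∞} ⊓ selmerLocalKerPrimary W ℚ_p p` (`𝓤∞`: `⊤` at `v_p`, unramified at `ℓ ≠ p`, `⊤` at `∞`):
a `p^∞`-Selmer class is Kummer at `p` and locally ZERO — in particular unramified — at every `ℓ ≠ p`. [cite: Kato2004Asterisque, §14.8 (p. 238)] -/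
theorem selmerGroupPInfty_le_kato (𝓤inf : SelmerStructure (primaryGaloisModule W p))
    (hUp : 𝓤inf (Sum.inr (primePlace p)) = ⊤)
    (hUur : ∀ v : HeightOneSpectrum (𝓞 ℚ), v ≠ primePlace p →
      𝓤inf (Sum.inr v) = unramifiedSubgroup (GaloisRep.toLocal v (primaryGaloisModule W p)) 1)
    (hUinl : ∀ w : InfinitePlace ℚ, 𝓤inf (Sum.inl w) = ⊤) :
    W.selmerGroupPInfty p ≤ 𝓤inf.selmerGroup ⊓ selmerLocalKerPrimary W ((primePlace p).adicCompletion ℚ) p := by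
  intro c hc
  refine ⟨(SelmerStructure.mem_selmerGroup_iff _ _).2 fun v => ?_, (AddSubgroup.mem_iInf.1 (AddSubgroup.mem_inf.1 hc).1) _⟩
  rcases v with w | v
  · rw [hUinl]; exact AddSubgroup.mem_top _
  · by_cases hv : v = primePlace p
    · subst hv; rw [hUp]; exact AddSubgroup.mem_top _
    · rw [hUur v hv, localization_eq_zero_of_mem_selmerGroupPInfty W p hv hc]; exact zero_mem _

end Rat

/-! ## §3 The Kummer structure of level `p^s · p^K` is unramified at the good places away from `p` -/

section Unramified

-- `K : Type` (universe `0`) as in X11b's `KummerPT.kummerSelmerStructure_inr_eq_unramifiedSubgroup`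
variable {K : Type} [Field K] [NumberField K] (W : WeierstrassCurve K) [W.IsElliptic] (p s k : ℕ) [Fact p.Prime]

/-- **`𝓚_{p^s p^k, v} = H¹_ur(K_v, E[p^s p^k])` at every good finite `v ∤ p`** (X11b `KummerPT.kummerSelmerStructure_inr_eq_unramifiedSubgroup` at level
`p^{s+k}`, transported along `p^{s+k} = p^s·p^k`). [cite: SilvermanAEC2009, Cor. X.4.4] [cite: MilneADT2006, Ch. I Prop. 3.8] -/
theorem kummerSelmerStructure_inr_eq_unramifiedSubgroup_pow_mul_pow {v : HeightOneSpectrum (𝓞 K)}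
    (hpv : ((p : ℕ) : 𝓞 K) ∉ v.asIdeal) (hv : W.HasGoodReductionAt v) :
    W.kummerSelmerStructure ((p ^ s * p ^ k : ℕ) : ℤ) (Sum.inr v) =
      unramifiedSubgroup (GaloisRep.toLocal v (W.torsionGaloisModule ((p ^ s * p ^ k : ℕ) : ℤ))) 1 := by
  have h := Rank1Residual.X11b.KummerPT.kummerSelmerStructure_inr_eq_unramifiedSubgroup W p (s + k) hpv hv
  rw [pow_add] at h
  exact h

end Unramified

end Summit.BirchSwinnertonDyer.BirchSwinnertonDyer.Theorems.KatoFiniteLevelCount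

end
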